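import Literature.NumberTheory.ConnesConsani.ScalingSiteTheta
import HarnessLib

/-!
# Connes–Consani, *Geometry of the scaling site* (2017), §5.2 "Symmetries": the arithmetic,
# relative and absolute Frobenius of the periodic orbit `C_p` and their action on divisors
# (Lemmas 5.7, 5.8, 5.9) — PROVED

Topic `Literature/NumberTheory/ConnesConsani`. Source: A. Connes, C. Consani, *Geometry of the
scaling site*, Selecta Math. (N.S.) 23 (2017) 1803–1850 = arXiv:1603.03191
[bib `ConnesConsani2017ScalingSite`], §5.2 (numbering of the Selecta paper). Continues
`ScalingSitePeriodicOrbit` / `ScalingSiteTheta` (`IsCpRational` = `𝒦(C_p)`, `cpOrder`, `CpDivisor`,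
`cpDeg`, `cpChi`, `CpDivisor.IsPrincipal`).

## The statements, verbatim

* "The analogue of the arithmetic Frobenius `Fr^a` on sections `f` of `𝒪_p` is defined as follows
  `Fr^a_μ(f)(λ) := μ f(μ⁻¹λ)` `∀λ, μ ∈ ℝ₊*`. This operator preserves the properties of `f` (`f` is
  convex, piecewise affine with slopes in `H_p` and periodic `f(pλ) = f(λ)`) as well as the algebraic
  operations `(∨, +)`." **Lemma 5.7.** "The action induced by `Fr^a_μ` on divisors is given by
  `D = Σ (H_j, h_j) ↦ Fr^a_μ(D) = Σ (μH_j, μh_j)`. This action preserves the homomorphism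
  `χ : Div(C_p) → ℤ/(p-1)ℤ` as well as the subgroup `𝒫` of principal divisors and it acts on the
  degree of a divisor by multiplication by `μ`."
* "Let `h ∈ H_p`, `h > 0`. One defines the operator `Fr^r_h` acting on functions by
  `Fr^r_h(f)(λ) := f(hλ)`". **Lemma 5.8.** "The action induced by `Fr^r_h` on divisors is given by
  `D = Σ (H_j, h_j) ↦ Fr^r_h(D) = Σ (h⁻¹H_j, h_j)`. This action preserves the degree
  `deg ∘ Fr^r_h = deg`, the subgroup `𝒫` of principal divisors and it acts on the invariant `χ` by
  multiplication by `χ(h) ∈ ℤ/(p-1)ℤ`."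
* "the action of the absolute Frobenius on functions is given, for any `h ∈ H_p⁺`, by the formula
  `Fr_h(f)(λ) := h f(λ)`", "`Fr_h = Fr^a_h ∘ Fr^r_h = Fr^r_h ∘ Fr^a_h`". **Lemma 5.9.** "The action
  induced by `Fr_h` on divisors is given by `D = Σ (H_j, h_j) ↦ Fr_h(D) = Σ (H_j, hh_j)`. This action
  is trivial on the points, it fixes `supp(D)`. It preserves the subgroup `𝒫` of principal divisors,
  acts on the invariant `χ` by multiplication by `χ(h) ∈ ℤ/(p-1)ℤ` and on the degree by
  multiplication by `h ∈ H_p⁺ ⊂ ℝ₊*`."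

## Rendering
In the coordinate `λ > 0` of `ScalingSitePeriodicOrbit` (point `H = λH_p`, divisor as the function
`λ ↦ D(λH_p) ∈ λH_p`): `Fr^a_μ(D)(λ) = μ D(μ⁻¹λ)` (the point `μH_j` carries `μh_j`),
`Fr^r_h(D)(λ) = D(hλ)` (the point `h⁻¹H_j` carries `h_j`), `Fr_h(D)(λ) = h D(λ)`. Everything below
is proved; there are no named facts.
-/

noncomputable section

open Set Filter
open scoped Topology

namespace Literature.NumberTheory.ConnesConsani

section Frobenius

variable {p : ℕ}

/-! ### Preliminaries: `H_p` and `χ` are multiplicative; sums over a rescaled fundamental domain -/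

/-- `H_p` is closed under multiplication. [cite: ConnesConsani2017ScalingSite, §5 (H_p ⊂ ℚ the ring ℤ[1/p])] -/
theorem IsPFraction.mul {x y : ℝ} (hx : IsPFraction p x) (hy : IsPFraction p y) :
    IsPFraction p (x * y) := by
  obtain ⟨a, m, rfl⟩ := hx
  obtain ⟨b, n, rfl⟩ := hy
  exact ⟨a * b, m + n, by rw [pow_add]; push_cast; field_simp⟩

/-- `χ` is multiplicative on `H_p`: `χ(xy) = χ(x)χ(y)` (`χ(a/p^n) = a mod (p-1)` is a ring map).
[cite: ConnesConsani2017ScalingSite, §5.1 (before Prop. 5.5) and Lemma 5.8 (proof: "χ(hk) = χ(h)χ(k)")] -/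
theorem pFractionChi_mul (hp : 0 < p) {x y : ℝ} (hx : IsPFraction p x) (hy : IsPFraction p y) :
    pFractionChi p (x * y) = pFractionChi p x * pFractionChi p y := by
  obtain ⟨a, m, rfl⟩ := hx
  obtain ⟨b, n, rfl⟩ := hy
  rw [pFractionChi_eq hp rfl, pFractionChi_eq hp rfl,
    pFractionChi_eq hp (a := a * b) (n := m + n) (by rw [pow_add]; push_cast; field_simp)]
  push_cast
  ring

/-- The representative map `λ ↦ λ̄ ∈ [1, p)` is injective on every fundamental domain `[c, pc)`.
[cite: ConnesConsani2017ScalingSite, Lemma 5.1 (i)] -/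
theorem injOn_fundRed_Ico (hp : 1 < p) {c : ℝ} (hc : 0 < c) :
    InjOn (fundRed p 1) (Ico c (p * c)) := by
  intro y hy y' hy' h
  obtain ⟨-, -, e⟩ := fundRed_spec hp one_pos (hc.trans_le hy.1)
  obtain ⟨-, -, e'⟩ := fundRed_spec hp one_pos (hc.trans_le hy'.1)
  generalize fundExp p 1 y = a at e
  generalize fundExp p 1 y' = b at e'
  rw [h] at e
  generalize fundRed p 1 y' = r at e e'
  have key : (p : ℝ) ^ b * y = (p : ℝ) ^ a * y' := by
    rw [e, e']
    ring
  exact (zpow_mul_eq_zpow_mul_iff hp hc hy.1 hy.2 hy'.1 hy'.2 key).2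

/-- Finite support of a class function on `[1, p)` transfers to any fundamental domain `[c, pc)`.
[cite: ConnesConsani2017ScalingSite, Lemma 5.1 (i)] -/
theorem finite_Ico_inter_support_of_periodic {M : Type*} [Zero M] (hp : 1 < p) (g : ℝ → M)
    (hg : ∀ x, 0 < x → g (p * x) = g x) (hfin : (Ico 1 (p : ℝ) ∩ Function.support g).Finite)
    {c : ℝ} (hc : 0 < c) : (Ico c (p * c) ∩ Function.support g).Finite := by
  have hp0 : 0 < p := zero_lt_one.trans hp
  refine Set.Finite.of_finite_image (f := fundRed p 1) (hfin.subset ?_)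
    ((injOn_fundRed_Ico hp hc).mono inter_subset_left)
  rintro _ ⟨y, ⟨hy, hyg⟩, rfl⟩
  have hy0 : 0 < y := hc.trans_le hy.1
  obtain ⟨h1, h2, h3⟩ := fundRed_spec hp one_pos hy0
  refine ⟨⟨h1, by simpa using h2⟩, ?_⟩
  rw [Function.mem_support] at hyg ⊢
  rwa [h3, periodic_zpow hp0 hg _ _ (zero_lt_one.trans_le h1)] at hyg

/-- **Rescaling the fundamental domain**: for a class function `g` (`g(pλ) = g(λ)`) with finite support
on `[1, p)` and any `c > 0`, `λ ↦ g(cλ)` has finite support on `[1, p)` and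
`Σ_{λ ∈ [1,p)} g(cλ) = Σ_{λ ∈ [1,p)} g(λ)` (both are the sum over one period).
[cite: ConnesConsani2017ScalingSite, Lemma 5.7–5.8 (proofs: the action on Σ_H)] -/
theorem finsum_Ico_comp_mul (hp : 1 < p) {M : Type*} [AddCommMonoid M] (g : ℝ → M)
    (hg : ∀ x, 0 < x → g (p * x) = g x) (hfin : (Ico 1 (p : ℝ) ∩ Function.support g).Finite)
    {c : ℝ} (hc : 0 < c) :
    (Ico 1 (p : ℝ) ∩ Function.support (fun x => g (c * x))).Finite ∧
      ∑ᶠ x ∈ Ico 1 (p : ℝ), g (c * x) = ∑ᶠ x ∈ Ico 1 (p : ℝ), g x := by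
  have hfinc := finite_Ico_inter_support_of_periodic hp g hg hfin hc
  have hbij : BijOn (fun x : ℝ => c * x) (Ico 1 (p : ℝ)) (Ico c (p * c)) := by
    refine ⟨fun x hx => ⟨by nlinarith [hx.1], by nlinarith [hx.2]⟩,
      fun x _ y _ h => mul_left_cancel₀ hc.ne' h, fun y hy => ?_⟩
    refine ⟨y / c, ⟨?_, ?_⟩, by simp [mul_div_cancel₀ _ hc.ne']⟩
    · rw [le_div_iff₀ hc]; linarith [hy.1]
    · rw [div_lt_iff₀ hc]; linarith [hy.2]
  refine ⟨?_, ?_⟩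
  · refine (hfinc.preimage (f := fun x : ℝ => c * x) fun x _ y _ h =>
      mul_left_cancel₀ hc.ne' h).subset fun x hx => ⟨hbij.1 hx.1, hx.2⟩
  · rw [finsum_mem_eq_of_bijOn _ hbij fun x _ => rfl]
    exact (finsum_Ico_eq_of_periodic hp g hg hc hfinc).2.symm

/-- The `χ`-density `λ ↦ χ(D(λ)/λ)` of a divisor is a class function.
[cite: ConnesConsani2017ScalingSite, Prop. 5.5 ("χ_H := χ ∘ λ⁻¹ … independent of the choice of λ")] -/
theorem CpDivisor.chi_density_mul_p (hp : 0 < p) (D : CpDivisor p) {x : ℝ} (hx : 0 < x) :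
    pFractionChi p (D.toFun (p * x) / (p * x)) = pFractionChi p (D.toFun x / x) := by
  rw [D.periodic x hx, mul_comm (p : ℝ) x, ← div_div, pFractionChi_div_p hp]

/-- `deg` as a sum over `Ico 1 p`. [cite: ConnesConsani2017ScalingSite, Prop. 5.4 (iii)] -/
theorem cpDeg_eq_finsum_Ico (D : CpDivisor p) : cpDeg D = ∑ᶠ x ∈ Ico 1 (p : ℝ), D.toFun x := by
  unfold cpDeg; rw [setOf_fundamentalDomain_eq]

/-- `χ` as a sum over `Ico 1 p`. [cite: ConnesConsani2017ScalingSite, Prop. 5.5] -/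
theorem cpChi_eq_finsum_Ico (D : CpDivisor p) :
    cpChi D = ∑ᶠ x ∈ Ico 1 (p : ℝ), pFractionChi p (D.toFun x / x) := by
  unfold cpChi; rw [setOf_fundamentalDomain_eq]

/-! ### The arithmetic Frobenius `Fr^a_μ` (Lemma 5.7) -/

/-- **The arithmetic Frobenius** "`Fr^a_μ(f)(λ) := μ f(μ⁻¹λ)` `∀λ, μ ∈ ℝ₊*`".
[cite: ConnesConsani2017ScalingSite, §5.2 (Arithmetic Frobenius)] -/
def frobArith (μ : ℝ) (f : ℝ → ℝ) (x : ℝ) : ℝ := μ * f (x / μ)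

/-- "This operator preserves the properties of `f` (… piecewise affine with slopes in `H_p` and
periodic `f(pλ) = f(λ)`)": `Fr^a_μ` maps `𝒦(C_p)` to itself (break points `μλ_j`, same slopes).
[cite: ConnesConsani2017ScalingSite, §5.2 (Arithmetic Frobenius)] -/
theorem isCpRational_frobArith {f : ℝ → ℝ} (hf : IsCpRational p f) {μ : ℝ} (hμ : 0 < μ) :
    IsCpRational p (frobArith μ f) := by
  obtain ⟨hper, n, lam, h, h0, hmono, hlast, hmem, hpiece⟩ := hf
  refine ⟨fun x hx => ?_, n, fun j => μ * lam j, h, mul_pos hμ h0,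
    fun i j hij => mul_lt_mul_of_pos_left (hmono hij) hμ,
    show μ * lam (Fin.last (n + 1)) = p * (μ * lam 0) by rw [hlast]; ring, hmem, ?_⟩
  · unfold frobArith
    rw [show p * x / μ = p * (x / μ) by ring, hper _ (div_pos hx hμ)]
  · intro j x hx1 hx2
    have hμ0 : μ ≠ 0 := hμ.ne'
    have e1 : μ * lam j.castSucc / μ = lam j.castSucc := mul_div_cancel_left₀ _ hμ0
    show μ * f (x / μ) = μ * f (μ * lam j.castSucc / μ) + h j * (x - μ * lam j.castSucc)
    rw [e1, hpiece j (x / μ) (by rw [le_div_iff₀ hμ]; linarith) (by rw [div_le_iff₀ hμ]; linarith)]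
    field_simp

/-- Right slopes are transported: `∂⁺(Fr^a_μ f)(λ) = ∂⁺f(μ⁻¹λ)`. [cite: ConnesConsani2017ScalingSite, §5.2 eq. (33) ((x,h₊,h₋) ↦ (μx, μh₊, μh₋))] -/
theorem hasDerivWithinAt_frobArith_Ioi {f : ℝ → ℝ} {μ x s : ℝ} (hμ : 0 < μ)
    (hf : HasDerivWithinAt f s (Ioi (x / μ)) (x / μ)) :
    HasDerivWithinAt (frobArith μ f) s (Ioi x) x := by
  have hg : HasDerivWithinAt (fun y : ℝ => y / μ) (1 / μ) (Ioi x) x := by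
    simpa using (hasDerivWithinAt_id x (Ioi x)).div_const μ
  have hcomp := hf.comp x hg fun y hy => by
    simp only [mem_Ioi] at hy ⊢; exact div_lt_div_of_pos_right hy hμ
  have h2 : HasDerivWithinAt (fun y => μ * f (y / μ)) (μ * (s * (1 / μ))) (Ioi x) x :=
    hcomp.const_mul μ
  have e : μ * (s * (1 / μ)) = s := by field_simp
  rw [e] at h2
  exact h2

/-- Left slopes are transported: `∂⁻(Fr^a_μ f)(λ) = ∂⁻f(μ⁻¹λ)`. [cite: ConnesConsani2017ScalingSite, §5.2 eq. (33)] -/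
theorem hasDerivWithinAt_frobArith_Iio {f : ℝ → ℝ} {μ x s : ℝ} (hμ : 0 < μ)
    (hf : HasDerivWithinAt f s (Iio (x / μ)) (x / μ)) :
    HasDerivWithinAt (frobArith μ f) s (Iio x) x := by
  have hg : HasDerivWithinAt (fun y : ℝ => y / μ) (1 / μ) (Iio x) x := by
    simpa using (hasDerivWithinAt_id x (Iio x)).div_const μ
  have hcomp := hf.comp x hg fun y hy => by
    simp only [mem_Iio] at hy ⊢; exact div_lt_div_of_pos_right hy hμ
  have h2 : HasDerivWithinAt (fun y => μ * f (y / μ)) (μ * (s * (1 / μ))) (Iio x) x :=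
    hcomp.const_mul μ
  have e : μ * (s * (1 / μ)) = s := by field_simp
  rw [e] at h2
  exact h2

/-- "the order is multiplied by `μ`": `ord_λ(Fr^a_μ f) = μ · ord_{μ⁻¹λ}(f)` for `f` with one-sided
slopes at `μ⁻¹λ`. [cite: ConnesConsani2017ScalingSite, Lemma 5.7 (proof)] -/
theorem cpOrder_frobArith_of_hasDerivWithinAt {f : ℝ → ℝ} {μ x sR sL : ℝ} (hμ : 0 < μ)
    (hR : HasDerivWithinAt f sR (Ioi (x / μ)) (x / μ))
    (hL : HasDerivWithinAt f sL (Iio (x / μ)) (x / μ)) :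
    cpOrder (frobArith μ f) x = μ * cpOrder f (x / μ) := by
  unfold cpOrder
  rw [(hasDerivWithinAt_frobArith_Ioi hμ hR).derivWithin (uniqueDiffWithinAt_Ioi x),
    (hasDerivWithinAt_frobArith_Iio hμ hL).derivWithin (uniqueDiffWithinAt_Iio x),
    hR.derivWithin (uniqueDiffWithinAt_Ioi _), hL.derivWithin (uniqueDiffWithinAt_Iio _)]
  field_simp

/-- For `f ∈ 𝒦(C_p)`: `ord_λ(Fr^a_μ f) = μ · ord_{μ⁻¹λ}(f)`, `λ > 0`. [cite: ConnesConsani2017ScalingSite, Lemma 5.7 (proof)] -/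
theorem IsCpRational.cpOrder_frobArith (hp : 1 < p) {f : ℝ → ℝ} (hf : IsCpRational p f) {μ : ℝ}
    (hμ : 0 < μ) {x : ℝ} (hx : 0 < x) :
    cpOrder (frobArith μ f) x = μ * cpOrder f (x / μ) :=
  cpOrder_frobArith_of_hasDerivWithinAt hμ (hf.hasDerivWithinAt_Ioi hp (div_pos hx hμ)).1
    (hf.hasDerivWithinAt_Iio hp (div_pos hx hμ)).1

/-- **`Fr^a_μ` on divisors**: "`D = Σ (H_j, h_j) ↦ Fr^a_μ(D) = Σ (μH_j, μh_j)`", i.e. the function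
`λ ↦ μ D(μ⁻¹λ)`. [cite: ConnesConsani2017ScalingSite, Lemma 5.7] -/
def CpDivisor.arithFrob (hp : 1 < p) (D : CpDivisor p) (μ : ℝ) (hμ : 0 < μ) : CpDivisor p where
  toFun x := μ * D.toFun (x / μ)
  periodic x hx := by rw [show (p : ℝ) * x / μ = p * (x / μ) by ring, D.periodic _ (div_pos hx hμ)]
  mem x hx := by
    rw [show μ * D.toFun (x / μ) / x = D.toFun (x / μ) / (x / μ) by field_simp]
    exact D.mem _ (div_pos hx hμ)
  finite_support := by
    have h := (finsum_Ico_comp_mul hp D.toFun D.periodic D.finite_inter_support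
      (inv_pos.2 hμ)).1
    refine h.subset fun x hx => ⟨⟨hx.1, hx.2.1⟩, ?_⟩
    rw [Function.mem_support, inv_mul_eq_div]
    exact fun h0 => hx.2.2 (by rw [h0, mul_zero])

/-- Values of `Fr^a_μ(D)`. [cite: ConnesConsani2017ScalingSite, Lemma 5.7] -/
theorem CpDivisor.arithFrob_apply (hp : 1 < p) (D : CpDivisor p) {μ : ℝ} (hμ : 0 < μ) (x : ℝ) :
    (D.arithFrob hp μ hμ).toFun x = μ * D.toFun (x / μ) := rfl

/-- **Lemma 5.7, degree**: "it acts on the degree of a divisor by multiplication by `μ`".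
[cite: ConnesConsani2017ScalingSite, Lemma 5.7] -/
theorem cpDeg_arithFrob (hp : 1 < p) (D : CpDivisor p) {μ : ℝ} (hμ : 0 < μ) :
    cpDeg (D.arithFrob hp μ hμ) = μ * cpDeg D := by
  have h := (finsum_Ico_comp_mul hp D.toFun D.periodic D.finite_inter_support (inv_pos.2 hμ)).2
  rw [cpDeg_eq_finsum_Ico, cpDeg_eq_finsum_Ico, ← h, mul_finsum_mem]
  refine finsum_mem_congr rfl fun x _ => ?_
  rw [CpDivisor.arithFrob_apply, inv_mul_eq_div]

/-- **Lemma 5.7, `χ`**: "This action preserves the homomorphism `χ`" (`χ(μh_j)` at the point `μH_j`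
is read through the same `k`, `h_j = λk`). [cite: ConnesConsani2017ScalingSite, Lemma 5.7] -/
theorem cpChi_arithFrob (hp : 1 < p) (D : CpDivisor p) {μ : ℝ} (hμ : 0 < μ) :
    cpChi (D.arithFrob hp μ hμ) = cpChi D := by
  have hp0 : 0 < p := zero_lt_one.trans hp
  rw [cpChi_eq_finsum_Ico, cpChi_eq_finsum_Ico]
  have h := (finsum_Ico_comp_mul hp (fun y => pFractionChi p (D.toFun y / y))
    (fun y hy => D.chi_density_mul_p hp0 hy) (D.finite_inter_support_chi hp0) (inv_pos.2 hμ)).2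
  rw [← h]
  refine finsum_mem_congr rfl fun x _ => ?_
  rw [CpDivisor.arithFrob_apply, inv_mul_eq_div,
    show μ * D.toFun (x / μ) / x = D.toFun (x / μ) / (x / μ) by field_simp]

/-- **Lemma 5.7, principal divisors**: `(Fr^a_μ f) = Fr^a_μ((f))` pointwise, so `Fr^a_μ` preserves
`𝒫`. [cite: ConnesConsani2017ScalingSite, Lemma 5.7] -/
theorem CpDivisor.IsPrincipal.arithFrob (hp : 1 < p) {D : CpDivisor p} (hD : D.IsPrincipal)
    {μ : ℝ} (hμ : 0 < μ) : (D.arithFrob hp μ hμ).IsPrincipal := by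
  obtain ⟨f, hf, hDf⟩ := hD
  refine ⟨frobArith μ f, isCpRational_frobArith hf hμ, fun x hx => ?_⟩
  rw [CpDivisor.arithFrob_apply, hf.cpOrder_frobArith hp hμ hx, hDf _ (div_pos hx hμ)]

/-- **Connes–Consani 2017, Lemma 5.7** (all clauses, `p` prime): `Fr^a_μ` maps `𝒦(C_p)` to itself
with `(Fr^a_μ f)(λ) = μ·(f)(μ⁻¹λ)`; on divisors it multiplies the degree by `μ`, preserves `χ` and
preserves principal divisors. [cite: ConnesConsani2017ScalingSite, Lemma 5.7] -/
theorem ConnesConsani2017_lemma_5_7 (hp : p.Prime) {μ : ℝ} (hμ : 0 < μ) :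
    (∀ f : ℝ → ℝ, IsCpRational p f → IsCpRational p (frobArith μ f) ∧
        ∀ x, 0 < x → cpOrder (frobArith μ f) x = μ * cpOrder f (x / μ)) ∧
      ∀ D : CpDivisor p, cpDeg (D.arithFrob hp.one_lt μ hμ) = μ * cpDeg D ∧
        cpChi (D.arithFrob hp.one_lt μ hμ) = cpChi D ∧
        (D.IsPrincipal → (D.arithFrob hp.one_lt μ hμ).IsPrincipal) :=
  ⟨fun _ hf => ⟨isCpRational_frobArith hf hμ, fun _ hx => hf.cpOrder_frobArith hp.one_lt hμ hx⟩,
    fun D => ⟨cpDeg_arithFrob hp.one_lt D hμ, cpChi_arithFrob hp.one_lt D hμ,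
      fun hD => hD.arithFrob hp.one_lt hμ⟩⟩

/-! ### The relative Frobenius `Fr^r_h` (Lemma 5.8) -/

/-- **The relative Frobenius** "`Fr^r_h(f)(λ) := f(hλ)` `∀λ`, `h ∈ H_p⁺`".
[cite: ConnesConsani2017ScalingSite, §5.2 (Relative Frobenius)] -/
def frobRel (h : ℝ) (f : ℝ → ℝ) (x : ℝ) : ℝ := f (h * x)

/-- `Fr^r_h` maps `𝒦(C_p)` to itself ("replacing the `n_j` by `hn_j`": slopes `h·h_j ∈ H_p`, break
points `h⁻¹λ_j`). [cite: ConnesConsani2017ScalingSite, §5.2 (Relative Frobenius)] -/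
theorem isCpRational_frobRel {f : ℝ → ℝ} (hf : IsCpRational p f) {h : ℝ} (hh : 0 < h)
    (hhp : IsPFraction p h) : IsCpRational p (frobRel h f) := by
  obtain ⟨hper, n, lam, s, h0, hmono, hlast, hmem, hpiece⟩ := hf
  refine ⟨fun x hx => ?_, n, fun j => lam j / h, fun j => h * s j, div_pos h0 hh,
    fun i j hij => div_lt_div_of_pos_right (hmono hij) hh,
    show lam (Fin.last (n + 1)) / h = p * (lam 0 / h) by rw [hlast]; ring,
    fun j => hhp.mul (hmem j), ?_⟩
  · unfold frobRel
    rw [show h * (p * x) = p * (h * x) by ring, hper _ (mul_pos hh hx)]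
  · intro j x hx1 hx2
    have hh0 : h ≠ 0 := hh.ne'
    have e1 : h * (lam j.castSucc / h) = lam j.castSucc := mul_div_cancel₀ _ hh0
    have hx1' : lam j.castSucc / h ≤ x := hx1
    have hx2' : x ≤ lam j.succ / h := hx2
    show f (h * x) = f (h * (lam j.castSucc / h)) + h * s j * (x - lam j.castSucc / h)
    rw [e1, hpiece j (h * x) (by rw [div_le_iff₀ hh] at hx1'; linarith)
      (by rw [le_div_iff₀ hh] at hx2'; linarith)]
    field_simp

/-- Slopes: `∂^±(Fr^r_h f)(λ) = h·∂^±f(hλ)` (right). [cite: ConnesConsani2017ScalingSite, §5.2 eq. (34)] -/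
theorem hasDerivWithinAt_frobRel_Ioi {f : ℝ → ℝ} {h x s : ℝ} (hh : 0 < h)
    (hf : HasDerivWithinAt f s (Ioi (h * x)) (h * x)) :
    HasDerivWithinAt (frobRel h f) (s * h) (Ioi x) x := by
  have hg : HasDerivWithinAt (fun y : ℝ => h * y) h (Ioi x) x := by
    simpa using (hasDerivWithinAt_id x (Ioi x)).const_mul h
  exact hf.comp x hg fun y hy => by
    simp only [mem_Ioi] at hy ⊢; exact mul_lt_mul_of_pos_left hy hh

/-- Slopes: `∂^±(Fr^r_h f)(λ) = h·∂^±f(hλ)` (left). [cite: ConnesConsani2017ScalingSite, §5.2 eq. (34)] -/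
theorem hasDerivWithinAt_frobRel_Iio {f : ℝ → ℝ} {h x s : ℝ} (hh : 0 < h)
    (hf : HasDerivWithinAt f s (Iio (h * x)) (h * x)) :
    HasDerivWithinAt (frobRel h f) (s * h) (Iio x) x := by
  have hg : HasDerivWithinAt (fun y : ℝ => h * y) h (Iio x) x := by
    simpa using (hasDerivWithinAt_id x (Iio x)).const_mul h
  exact hf.comp x hg fun y hy => by
    simp only [mem_Iio] at hy ⊢; exact mul_lt_mul_of_pos_left hy hh

/-- `ord_λ(Fr^r_h f) = ord_{hλ}(f)` for `f` with one-sided slopes at `hλ`.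
[cite: ConnesConsani2017ScalingSite, Lemma 5.8 (proof)] -/
theorem cpOrder_frobRel_of_hasDerivWithinAt {f : ℝ → ℝ} {h x sR sL : ℝ} (hh : 0 < h)
    (hR : HasDerivWithinAt f sR (Ioi (h * x)) (h * x))
    (hL : HasDerivWithinAt f sL (Iio (h * x)) (h * x)) :
    cpOrder (frobRel h f) x = cpOrder f (h * x) := by
  unfold cpOrder
  rw [(hasDerivWithinAt_frobRel_Ioi hh hR).derivWithin (uniqueDiffWithinAt_Ioi x),
    (hasDerivWithinAt_frobRel_Iio hh hL).derivWithin (uniqueDiffWithinAt_Iio x),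
    hR.derivWithin (uniqueDiffWithinAt_Ioi _), hL.derivWithin (uniqueDiffWithinAt_Iio _)]
  ring

/-- For `f ∈ 𝒦(C_p)`: `ord_λ(Fr^r_h f) = ord_{hλ}(f)`, `λ > 0`. [cite: ConnesConsani2017ScalingSite, Lemma 5.8 (proof)] -/
theorem IsCpRational.cpOrder_frobRel (hp : 1 < p) {f : ℝ → ℝ} (hf : IsCpRational p f) {h : ℝ}
    (hh : 0 < h) {x : ℝ} (hx : 0 < x) : cpOrder (frobRel h f) x = cpOrder f (h * x) :=
  cpOrder_frobRel_of_hasDerivWithinAt hh (hf.hasDerivWithinAt_Ioi hp (mul_pos hh hx)).1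
    (hf.hasDerivWithinAt_Iio hp (mul_pos hh hx)).1

/-- **`Fr^r_h` on divisors**: "`D = Σ (H_j, h_j) ↦ Fr^r_h(D) = Σ (h⁻¹H_j, h_j)`", i.e. the function
`λ ↦ D(hλ)` (`h ∈ H_p⁺`). [cite: ConnesConsani2017ScalingSite, Lemma 5.8] -/
def CpDivisor.relFrob (hp : 1 < p) (D : CpDivisor p) (h : ℝ) (hh : 0 < h) (hhp : IsPFraction p h) :
    CpDivisor p where
  toFun x := D.toFun (h * x)
  periodic x hx := by rw [show h * (p * x) = p * (h * x) by ring, D.periodic _ (mul_pos hh hx)]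
  mem x hx := by
    rw [show D.toFun (h * x) / x = h * (D.toFun (h * x) / (h * x)) by field_simp]
    exact hhp.mul (D.mem _ (mul_pos hh hx))
  finite_support := by
    have hf := (finsum_Ico_comp_mul hp D.toFun D.periodic D.finite_inter_support hh).1
    exact hf.subset fun x hx => ⟨⟨hx.1, hx.2.1⟩, hx.2.2⟩

/-- Values of `Fr^r_h(D)`. [cite: ConnesConsani2017ScalingSite, Lemma 5.8] -/
theorem CpDivisor.relFrob_apply (hp : 1 < p) (D : CpDivisor p) {h : ℝ} (hh : 0 < h)
    (hhp : IsPFraction p h) (x : ℝ) : (D.relFrob hp h hh hhp).toFun x = D.toFun (h * x) := rfl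

/-- **Lemma 5.8, degree**: "This action preserves the degree `deg ∘ Fr^r_h = deg`".
[cite: ConnesConsani2017ScalingSite, Lemma 5.8] -/
theorem cpDeg_relFrob (hp : 1 < p) (D : CpDivisor p) {h : ℝ} (hh : 0 < h) (hhp : IsPFraction p h) :
    cpDeg (D.relFrob hp h hh hhp) = cpDeg D := by
  rw [cpDeg_eq_finsum_Ico, cpDeg_eq_finsum_Ico]
  exact (finsum_Ico_comp_mul hp D.toFun D.periodic D.finite_inter_support hh).2

/-- **Lemma 5.8, `χ`**: "it acts on the invariant `χ` by multiplication by `χ(h)`".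
[cite: ConnesConsani2017ScalingSite, Lemma 5.8] -/
theorem cpChi_relFrob (hp : 1 < p) (D : CpDivisor p) {h : ℝ} (hh : 0 < h) (hhp : IsPFraction p h) :
    cpChi (D.relFrob hp h hh hhp) = pFractionChi p h * cpChi D := by
  have hp0 : 0 < p := zero_lt_one.trans hp
  rw [cpChi_eq_finsum_Ico, cpChi_eq_finsum_Ico]
  obtain ⟨hfin, hsum⟩ := finsum_Ico_comp_mul hp (fun y => pFractionChi p (D.toFun y / y))
    (fun y hy => D.chi_density_mul_p hp0 hy) (D.finite_inter_support_chi hp0) hh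
  have hmap := (AddMonoidHom.mulLeft (pFractionChi p h)).map_finsum_mem' hfin
  simp only [AddMonoidHom.coe_mulLeft] at hmap
  rw [← hsum, hmap]
  refine finsum_mem_congr rfl fun x hx => ?_
  rw [CpDivisor.relFrob_apply,
    show D.toFun (h * x) / x = h * (D.toFun (h * x) / (h * x)) by
      have : 0 < x := zero_lt_one.trans_le hx.1
      field_simp,
    pFractionChi_mul hp0 hhp (D.mem _ (mul_pos hh (zero_lt_one.trans_le hx.1)))]

/-- **Lemma 5.8, principal divisors**: `(Fr^r_h f) = Fr^r_h((f))`, so `𝒫` is preserved.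
[cite: ConnesConsani2017ScalingSite, Lemma 5.8] -/
theorem CpDivisor.IsPrincipal.relFrob (hp : 1 < p) {D : CpDivisor p} (hD : D.IsPrincipal)
    {h : ℝ} (hh : 0 < h) (hhp : IsPFraction p h) : (D.relFrob hp h hh hhp).IsPrincipal := by
  obtain ⟨f, hf, hDf⟩ := hD
  refine ⟨frobRel h f, isCpRational_frobRel hf hh hhp, fun x hx => ?_⟩
  rw [CpDivisor.relFrob_apply, hf.cpOrder_frobRel hp hh hx, hDf _ (mul_pos hh hx)]

/-- **Connes–Consani 2017, Lemma 5.8** (all clauses, `p` prime, `h ∈ H_p⁺`): `Fr^r_h` maps `𝒦(C_p)`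
to itself with `(Fr^r_h f)(λ) = (f)(hλ)`; on divisors it preserves the degree, multiplies `χ` by
`χ(h)`, and preserves principal divisors. [cite: ConnesConsani2017ScalingSite, Lemma 5.8] -/
theorem ConnesConsani2017_lemma_5_8 (hp : p.Prime) {h : ℝ} (hh : 0 < h) (hhp : IsPFraction p h) :
    (∀ f : ℝ → ℝ, IsCpRational p f → IsCpRational p (frobRel h f) ∧
        ∀ x, 0 < x → cpOrder (frobRel h f) x = cpOrder f (h * x)) ∧
      ∀ D : CpDivisor p, cpDeg (D.relFrob hp.one_lt h hh hhp) = cpDeg D ∧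
        cpChi (D.relFrob hp.one_lt h hh hhp) = pFractionChi p h * cpChi D ∧
        (D.IsPrincipal → (D.relFrob hp.one_lt h hh hhp).IsPrincipal) :=
  ⟨fun _ hf => ⟨isCpRational_frobRel hf hh hhp, fun _ hx => hf.cpOrder_frobRel hp.one_lt hh hx⟩,
    fun D => ⟨cpDeg_relFrob hp.one_lt D hh hhp, cpChi_relFrob hp.one_lt D hh hhp,
      fun hD => hD.relFrob hp.one_lt hh hhp⟩⟩

/-! ### The absolute Frobenius `Fr_h` (Lemma 5.9) -/

/-- **The absolute Frobenius** "`Fr_h(f)(λ) := h f(λ)` `∀λ`, `h ∈ H_p⁺`".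
[cite: ConnesConsani2017ScalingSite, §5.2 (Absolute Frobenius)] -/
def frobAbs (h : ℝ) (f : ℝ → ℝ) (x : ℝ) : ℝ := h * f x

/-- "`Fr_h = Fr^a_h ∘ Fr^r_h = Fr^r_h ∘ Fr^a_h`". [cite: ConnesConsani2017ScalingSite, §5.2 eq. (35)] -/
theorem frobAbs_eq_comp {h : ℝ} (hh : h ≠ 0) (f : ℝ → ℝ) :
    frobAbs h f = frobArith h (frobRel h f) ∧ frobAbs h f = frobRel h (frobArith h f) := by
  constructor <;> funext x <;> simp only [frobAbs, frobArith, frobRel, mul_div_cancel₀ _ hh,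
    mul_div_cancel_left₀ _ hh]

/-- `Fr_h` maps `𝒦(C_p)` to itself (slopes `h·h_j ∈ H_p`). [cite: ConnesConsani2017ScalingSite, §5.2 (Absolute Frobenius)] -/
theorem isCpRational_frobAbs {f : ℝ → ℝ} (hf : IsCpRational p f) {h : ℝ}
    (hhp : IsPFraction p h) : IsCpRational p (frobAbs h f) := by
  obtain ⟨hper, n, lam, s, h0, hmono, hlast, hmem, hpiece⟩ := hf
  refine ⟨fun x hx => ?_, n, lam, fun j => h * s j, h0, hmono, hlast, fun j => hhp.mul (hmem j), ?_⟩
  · unfold frobAbs; rw [hper x hx]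
  · intro j x hx1 hx2
    unfold frobAbs
    rw [hpiece j x hx1 hx2]
    ring

/-- `ord_λ(Fr_h f) = h · ord_λ(f)` for `f` with one-sided slopes at `λ`.
[cite: ConnesConsani2017ScalingSite, Lemma 5.9 (proof)] -/
theorem cpOrder_frobAbs_of_hasDerivWithinAt {f : ℝ → ℝ} {h x sR sL : ℝ}
    (hR : HasDerivWithinAt f sR (Ioi x) x) (hL : HasDerivWithinAt f sL (Iio x) x) :
    cpOrder (frobAbs h f) x = h * cpOrder f x := by
  have hR' : HasDerivWithinAt (frobAbs h f) (h * sR) (Ioi x) x := hR.const_mul h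
  have hL' : HasDerivWithinAt (frobAbs h f) (h * sL) (Iio x) x := hL.const_mul h
  unfold cpOrder
  rw [hR'.derivWithin (uniqueDiffWithinAt_Ioi x), hL'.derivWithin (uniqueDiffWithinAt_Iio x),
    hR.derivWithin (uniqueDiffWithinAt_Ioi x), hL.derivWithin (uniqueDiffWithinAt_Iio x)]
  ring

/-- For `f ∈ 𝒦(C_p)`: `ord_λ(Fr_h f) = h · ord_λ(f)`. [cite: ConnesConsani2017ScalingSite, Lemma 5.9 (proof)] -/
theorem IsCpRational.cpOrder_frobAbs (hp : 1 < p) {f : ℝ → ℝ} (hf : IsCpRational p f) (h : ℝ)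
    {x : ℝ} (hx : 0 < x) : cpOrder (frobAbs h f) x = h * cpOrder f x :=
  cpOrder_frobAbs_of_hasDerivWithinAt (hf.hasDerivWithinAt_Ioi hp hx).1
    (hf.hasDerivWithinAt_Iio hp hx).1

/-- **`Fr_h` on divisors**: "`D = Σ (H_j, h_j) ↦ Fr_h(D) = Σ (H_j, hh_j)`", i.e. `λ ↦ h D(λ)`
("trivial on the points, it fixes `supp(D)`"). [cite: ConnesConsani2017ScalingSite, Lemma 5.9] -/
def CpDivisor.absFrob (D : CpDivisor p) (h : ℝ) (hhp : IsPFraction p h) : CpDivisor p where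
  toFun x := h * D.toFun x
  periodic x hx := by rw [D.periodic x hx]
  mem x hx := by rw [mul_div_assoc]; exact hhp.mul (D.mem x hx)
  finite_support := D.finite_support.subset fun x hx =>
    ⟨hx.1, hx.2.1, fun h0 => hx.2.2 (by rw [h0, mul_zero])⟩

/-- Values of `Fr_h(D)`. [cite: ConnesConsani2017ScalingSite, Lemma 5.9] -/
theorem CpDivisor.absFrob_apply (D : CpDivisor p) {h : ℝ} (hhp : IsPFraction p h) (x : ℝ) :
    (D.absFrob h hhp).toFun x = h * D.toFun x := rfl

/-- **Lemma 5.9, support**: "it fixes `supp(D)`". [cite: ConnesConsani2017ScalingSite, Lemma 5.9] -/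
theorem CpDivisor.support_absFrob (D : CpDivisor p) {h : ℝ} (hh : 0 < h) (hhp : IsPFraction p h) :
    Function.support (D.absFrob h hhp).toFun = Function.support D.toFun := by
  ext x
  simp only [Function.mem_support, CpDivisor.absFrob_apply, ne_eq, mul_eq_zero, hh.ne', false_or]

/-- **Lemma 5.9, degree**: "on the degree by multiplication by `h`". [cite: ConnesConsani2017ScalingSite, Lemma 5.9] -/
theorem cpDeg_absFrob (D : CpDivisor p) {h : ℝ} (hhp : IsPFraction p h) :
    cpDeg (D.absFrob h hhp) = h * cpDeg D := by
  rw [cpDeg_eq_finsum_Ico, cpDeg_eq_finsum_Ico, mul_finsum_mem]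
  rfl

/-- **Lemma 5.9, `χ`**: "acts on the invariant `χ` by multiplication by `χ(h)`".
[cite: ConnesConsani2017ScalingSite, Lemma 5.9] -/
theorem cpChi_absFrob (hp : 1 < p) (D : CpDivisor p) {h : ℝ} (hhp : IsPFraction p h) :
    cpChi (D.absFrob h hhp) = pFractionChi p h * cpChi D := by
  have hp0 : 0 < p := zero_lt_one.trans hp
  have hmap := (AddMonoidHom.mulLeft (pFractionChi p h)).map_finsum_mem'
    (D.finite_inter_support_chi hp0)
  simp only [AddMonoidHom.coe_mulLeft] at hmap
  rw [cpChi_eq_finsum_Ico, cpChi_eq_finsum_Ico, hmap]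
  refine finsum_mem_congr rfl fun x hx => ?_
  rw [CpDivisor.absFrob_apply, mul_div_assoc,
    pFractionChi_mul hp0 hhp (D.mem _ (zero_lt_one.trans_le hx.1))]

/-- **Lemma 5.9, principal divisors**: `(Fr_h f) = Fr_h((f))`, so `𝒫` is preserved.
[cite: ConnesConsani2017ScalingSite, Lemma 5.9] -/
theorem CpDivisor.IsPrincipal.absFrob (hp : 1 < p) {D : CpDivisor p} (hD : D.IsPrincipal)
    {h : ℝ} (hhp : IsPFraction p h) : (D.absFrob h hhp).IsPrincipal := by
  obtain ⟨f, hf, hDf⟩ := hD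
  refine ⟨frobAbs h f, isCpRational_frobAbs hf hhp, fun x hx => ?_⟩
  rw [CpDivisor.absFrob_apply, hf.cpOrder_frobAbs hp h hx, hDf x hx]

/-- **Connes–Consani 2017, Lemma 5.9** (all clauses, `p` prime, `h ∈ H_p⁺`): `Fr_h` maps `𝒦(C_p)` to
itself with `(Fr_h f) = h·(f)`; on divisors it fixes the support, multiplies the degree by `h`, `χ`
by `χ(h)`, and preserves principal divisors. [cite: ConnesConsani2017ScalingSite, Lemma 5.9] -/
theorem ConnesConsani2017_lemma_5_9 (hp : p.Prime) {h : ℝ} (hh : 0 < h) (hhp : IsPFraction p h) :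
    (∀ f : ℝ → ℝ, IsCpRational p f → IsCpRational p (frobAbs h f) ∧
        ∀ x, 0 < x → cpOrder (frobAbs h f) x = h * cpOrder f x) ∧
      ∀ D : CpDivisor p,
        Function.support (D.absFrob h hhp).toFun = Function.support D.toFun ∧
        cpDeg (D.absFrob h hhp) = h * cpDeg D ∧
        cpChi (D.absFrob h hhp) = pFractionChi p h * cpChi D ∧
        (D.IsPrincipal → (D.absFrob h hhp).IsPrincipal) :=
  ⟨fun _ hf => ⟨isCpRational_frobAbs hf hhp, fun _ hx => hf.cpOrder_frobAbs hp.one_lt h hx⟩,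
    fun D => ⟨D.support_absFrob hh hhp, cpDeg_absFrob D hhp, cpChi_absFrob hp.one_lt D hhp,
      fun hD => hD.absFrob hp.one_lt hhp⟩⟩

end Frobenius

end Literature.NumberTheory.ConnesConsani
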